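import Literature.NumberTheory.Transcendental.BrownZagierFormulaProofs
import Literature.NumberTheory.Transcendental.MultipleZetaEulerDecompositionProofs
import Literature.NumberTheory.Transcendental.MultipleZetaSumFormulaProofs
import Literature.NumberTheory.Transcendental.MZVDualIndex
import Mathlib.LinearAlgebra.Dual.Lemmas
import HarnessLib

/-!
# Brown's theorem in low depth, unconditionally: all MZVs of depth one, and all double zeta
# values of odd weight, lie in the Hoffman span

Sibling proof file in the cone of the named fact
`Literature.NumberTheory.Transcendental.hoffmanSpan_eq_mzvSpace` (Brown 2012, Theorem 1.1 ⟹
Hoffman's Conjecture 2: the Hoffman elements `ζ(s)`, `s ∈ {2,3}^×`, span all MZVs of each weight).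

## Depth one (all weights)

With Zagier's theorem for all `a, b` (`BrownZagierFormulaProofs`, after Lai–Lupu–Orr) and Brown's
`2`-adic level-one argument (`BrownLevelOneProofs`), the odd zeta values `ζ(2n+1)` lie in the
Hoffman span (`multipleZeta_odd_mem_hoffmanSpan`); the even ones do by Euler
(`ζ(2j) ∈ ℚ π^{2j} = ℚ ζ({2}ʲ)`, `MultipleZetaRepeatedTwosProofs`). Hence, UNCONDITIONALLY:

* `multipleZeta_singleton_mem_hoffmanSpan` : `ζ(k) ∈ hoffmanSpan k` for every `k ≥ 2`;
* `multipleZeta_singleton_mul_replicate_two_mem_hoffmanSpan`,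
  `pi_pow_mul_multipleZeta_singleton_mem_hoffmanSpan` : `ζ(k) ζ({2}ᵐ)`, `π^{2m} ζ(k) ∈ hoffmanSpan (k+2m)`;
* `multipleZeta_mem_hoffmanSpan_of_length_eq_one`.

## Depth two, odd weight (Euler's theorem)

**Euler's theorem** (1775; Nielsen), [Eie2013, Appendix B, Theorems B.1.1–B.1.2]: for an odd
weight `k = r + s`, every double zeta value `ζ(r,s)` (`r ≥ 2`, `s ≥ 1`) is a polynomial in single
zeta values — precisely, a `ℚ`-linear combination of `ζ(k)` and the products `ζ(a) ζ(k-a)`,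
`2 ≤ a ≤ k-2`. We prove the qualitative statement `multipleZeta_depth_two_mem_of_odd` for ANY
`ℚ`-subspace `V ∋ ζ(k), ζ(a)ζ(k-a)`, hence for the span of these (`…_mem_span_of_odd`, Euler's
theorem) and for `hoffmanSpan k` (`multipleZeta_depth_two_mem_hoffmanSpan_of_odd`), since
`ζ(a) ζ(k-a) ∈ hoffmanSpan k` when one of `a`, `k - a` is even (depth one above).

Proof (ours, by generating polynomials; the inputs are the tree's finite double shuffle relations):
let `z_r` be the class of `ζ(r, k-r)` (`2 ≤ r ≤ k-1`) modulo `V` and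
`F(X,Y) = ∑_r z_r X^{r-1} Y^{k-1-r}`. The stuffle products `ζ(a)ζ(k-a) = ζ(a,k-a) + ζ(k-a,a) + ζ(k)`
(`multipleZeta_mul`) give `F(X,Y) + F(Y,X) = c (X^{k-2} + Y^{k-2})`, `c = z_{k-1}`; the Euler
decompositions `ζ(a)ζ(k-a) = ∑_r [C(r-1,a-1) + C(r-1,k-a-1)] ζ(r,k-r)`
(`multipleZeta_mul_eq_euler_decomposition`) together with the sum formula `∑_r ζ(r,k-r) = ζ(k)`
(`multipleZeta_sum_formula_depth_two`) give `F(X+Y,Y) + F(X+Y,X) = c (X^{k-2} + Y^{k-2})`. Hence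
`F(X,Y) = F(X-Y,X) + c (Y^{k-2} - X^{k-2})`; iterating the order-six substitution
`(X,Y) ↦ (X-Y,X)` three times (`(X,Y) ↦ (-X,-Y)`) and using that `F` is homogeneous of ODD degree
`k - 2` gives `2 F(X,Y) = 2c Y^{k-2}`, and `F` has no monomial `Y^{k-2}`: so `c = 0` and `F = 0`
(the argument is run on scalar coefficients `φ(z_r)`, `φ ∈ (ℝ/V)^*`, `EulerOddWeight.*`).

No definitions, no named facts.

## References

* [Brown2012] F. Brown, *Mixed Tate motives over ℤ*, Ann. of Math. 175 (2012), 949–976, Theorem 1.1,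
  Theorems 7.3–7.4.
* [Eie2013] M. Eie, *The theory of multiple zeta values with applications in combinatorics*, World
  Scientific (2013), Appendix B.1, Theorems B.1.1–B.1.2 (Euler's evaluation of the double Euler
  sums `S_{p,q}` of odd weight) and Proposition B.3.1 (Euler's decomposition theorem).
* [Hoffman1997] M. E. Hoffman, *The algebra of multiple harmonic series*, J. Algebra 194 (1997),
  Theorem 4.2 (harmonic product).
-/

noncomputable section

open Real Finset
open scoped Nat

namespace Literature.NumberTheory.Transcendental


/-- **`ζ(k) ∈ hoffmanSpan k` for every `k ≥ 2`** — Brown's Theorem 1.1 (Hoffman's Conjecture 2) for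
all multiple zeta values of depth one, UNCONDITIONALLY: even `k` by Euler (`ζ(2j) ∈ ℚ π^{2j}`,
`multipleZeta_singleton_mem_hoffmanSpan_of_even`), odd `k = 2n+1` by
`multipleZeta_odd_mem_hoffmanSpan`. [cite: Brown2012, Theorem 1.1] -/
theorem multipleZeta_singleton_mem_hoffmanSpan {k : ℕ} (hk : 2 ≤ k) :
    multipleZeta [k] ∈ hoffmanSpan k := by
  rcases Nat.even_or_odd k with he | ho
  · exact multipleZeta_singleton_mem_hoffmanSpan_of_even he (by omega)
  · obtain ⟨n, rfl⟩ := ho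
    exact multipleZeta_odd_mem_hoffmanSpan n (by omega)

/-- **`ζ(k) ζ({2}ᵐ) ∈ hoffmanSpan (k + 2m)`** for all `k ≥ 2`, `m ≥ 0`, unconditionally (odd `k`:
`multipleZeta_odd_mul_twos_mem_hoffmanSpan`; even `k = 2a`: `ζ(2a) ζ({2}ᵐ) ∈ ℚ π^{2a+2m}`).
[cite: Brown2012, Theorem 1.1] -/
theorem multipleZeta_singleton_mul_replicate_two_mem_hoffmanSpan {k : ℕ} (hk : 2 ≤ k) (m : ℕ) :
    multipleZeta [k] * multipleZeta (List.replicate m 2) ∈ hoffmanSpan (k + 2 * m) := by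
  rcases Nat.even_or_odd k with he | ho
  · obtain ⟨a, rfl⟩ := he
    have ha : a ≠ 0 := by omega
    set q : ℚ := (-1) ^ (a + 1) * 2 ^ (2 * a - 1) * bernoulli (2 * a) / (2 * a)! / (2 * m + 1)! with hq
    have h : multipleZeta [a + a] * multipleZeta (List.replicate m 2) = q • π ^ (2 * (a + m)) := by
      rw [← two_mul, multipleZeta_two_mul_eq ha, multipleZeta_replicate_two, hq, Rat.smul_def]
      push_cast
      have hf : ((2 * m + 1)! : ℝ) ≠ 0 := by positivity
      have hf' : ((2 * a)! : ℝ) ≠ 0 := by positivity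
      field_simp
      ring
    rw [h, show a + a + 2 * m = 2 * (a + m) by ring]
    exact Submodule.smul_mem _ _ (pi_pow_two_mul_mem_hoffmanSpan (a + m))
  · obtain ⟨j, rfl⟩ := ho
    obtain ⟨i, rfl⟩ : ∃ i, j = i + 1 := ⟨j - 1, by omega⟩
    have h := multipleZeta_odd_mul_twos_mem_hoffmanSpan (i + 1 + m) i (by omega)
    rw [show i + 1 + m - 1 - i = m by omega] at h
    rw [show 2 * (i + 1) + 1 + 2 * m = 2 * (i + 1 + m) + 1 by ring,
      show 2 * (i + 1) + 1 = 2 * i + 3 by ring]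
    exact h

/-- **`π^{2m} ζ(k) ∈ hoffmanSpan (k + 2m)`** for all `k ≥ 2`, `m ≥ 0`, unconditionally.
[cite: Brown2012, Theorem 1.1] -/
theorem pi_pow_mul_multipleZeta_singleton_mem_hoffmanSpan {k : ℕ} (hk : 2 ≤ k) (m : ℕ) :
    π ^ (2 * m) * multipleZeta [k] ∈ hoffmanSpan (k + 2 * m) := by
  have h := multipleZeta_singleton_mul_replicate_two_mem_hoffmanSpan hk m
  rw [multipleZeta_replicate_two] at h
  have hf : ((2 * m + 1)! : ℝ) ≠ 0 := by positivity
  have key : π ^ (2 * m) * multipleZeta [k] =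
      (((2 * m + 1)! : ℕ) : ℚ) • (multipleZeta [k] * (π ^ (2 * m) / (2 * m + 1)!)) := by
    rw [Rat.smul_def]
    push_cast
    field_simp
  rw [key]
  exact Submodule.smul_mem _ _ h

/-- The depth-one part of `𝒵_k` lies in the Hoffman span: every `ζ(s)` with `s` admissible of
length one and weight `k` is in `hoffmanSpan k`. [cite: Brown2012, Theorem 1.1] -/
theorem multipleZeta_mem_hoffmanSpan_of_length_eq_one {s : List ℕ} (hs : MZV.IsAdmissible s)
    (hl : s.length = 1) : multipleZeta s ∈ hoffmanSpan (MZV.weight s) := by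
  match s, hl with
  | [k], _ =>
    have hk : 2 ≤ k := by simpa using hs.2 (by simp)
    simpa [MZV.weight] using multipleZeta_singleton_mem_hoffmanSpan hk

/-! ### The parity lemma for the depth-two double shuffle system (pure algebra over `ℚ`) -/

namespace EulerOddWeight


/-- Step 1 — the stuffle relations in generating form: `F(x,y) + F(y,x) = c (x^{k-2} + y^{k-2})`,
`c = f (k-1)`, for `F(x,y) = ∑_{2 ≤ r < k} f r · x^{r-1} y^{k-1-r}`. [folklore] -/
theorem gf_symm {k : ℕ} (h3 : 3 ≤ k) (f : ℕ → ℚ)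
    (hS : ∀ a, 2 ≤ a → a + 2 ≤ k → f a + f (k - a) = 0)
    (F : ℚ → ℚ → ℚ) (hF : ∀ x y, F x y = ∑ r ∈ Finset.Ico 2 k, f r * (x ^ (r - 1) * y ^ (k - 1 - r)))
    (x y : ℚ) : F x y + F y x = f (k - 1) * (x ^ (k - 2) + y ^ (k - 2)) := by
  rw [hF, hF]
  -- write both sums over `a ∈ Finset.range (k - 1)` with `r = a + 1`... we reindex the second sum by
  -- `r ↦ k - r`.
  have e1 : ∑ r ∈ Finset.Ico 2 k, f r * (y ^ (r - 1) * x ^ (k - 1 - r)) =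
      ∑ r ∈ Finset.Ico 1 (k - 1), f (k - r) * (x ^ (r - 1) * y ^ (k - 1 - r)) := by
    -- reflection r ↦ k - r maps Finset.Ico 2 k onto Finset.Ico 1 (k-1)
    refine Finset.sum_nbij' (fun r => k - r) (fun r => k - r) ?_ ?_ ?_ ?_ ?_
    · intro r hr; simp only [Finset.mem_Ico] at hr ⊢; omega
    · intro r hr; simp only [Finset.mem_Ico] at hr ⊢; omega
    · intro r hr; simp only [Finset.mem_Ico] at hr; omega
    · intro r hr; simp only [Finset.mem_Ico] at hr; omega
    · intro r hr; simp only [Finset.mem_Ico] at hr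
      rw [show k - (k - r) = r by omega, show k - r - 1 = k - 1 - r by omega,
        show k - 1 - (k - r) = r - 1 by omega]
      ring
  rw [e1]
  -- split the first sum: r = k-1 apart; the second: r = 1 apart; the rest pairs up
  have hk1 : Finset.Ico 2 k = Finset.Ico 2 (k - 1) ∪ {k - 1} := by
    ext r; simp only [Finset.mem_union, Finset.mem_Ico, Finset.mem_singleton]; omega
  have hk2 : Finset.Ico 1 (k - 1) = {1} ∪ Finset.Ico 2 (k - 1) := by
    ext r; simp only [Finset.mem_union, Finset.mem_Ico, Finset.mem_singleton]; omega
  have hd1 : Disjoint (Finset.Ico 2 (k - 1)) {k - 1} := by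
    rw [Finset.disjoint_singleton_right, Finset.mem_Ico]; omega
  have hd2 : Disjoint ({1} : Finset ℕ) (Finset.Ico 2 (k - 1)) := by
    rw [Finset.disjoint_singleton_left, Finset.mem_Ico]; omega
  rw [hk1, sum_union hd1, sum_singleton, hk2, sum_union hd2, sum_singleton,
    show k - 1 - 1 = k - 2 by omega, show k - 1 - (k - 1) = 0 by omega, show 1 - 1 = 0 by rfl]
  have hmid : ∑ r ∈ Finset.Ico 2 (k - 1), f r * (x ^ (r - 1) * y ^ (k - 1 - r)) +
      ∑ r ∈ Finset.Ico 2 (k - 1), f (k - r) * (x ^ (r - 1) * y ^ (k - 1 - r)) = 0 := by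
    rw [← sum_add_distrib]
    refine sum_eq_zero fun r hr => ?_
    rw [Finset.mem_Ico] at hr
    rw [← add_mul, hS r hr.1 (by omega), zero_mul]
  simp only [pow_zero, mul_one, one_mul]
  linear_combination hmid

/-- Expansion of `F (x + y) y` in monomials (binomial theorem). [folklore] -/
theorem gf_shift_left {k : ℕ} (h3 : 3 ≤ k) (f : ℕ → ℚ)
    (F : ℚ → ℚ → ℚ) (hF : ∀ x y, F x y = ∑ r ∈ Finset.Ico 2 k, f r * (x ^ (r - 1) * y ^ (k - 1 - r)))
    (x y : ℚ) : F (x + y) y =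
      ∑ i ∈ Finset.range (k - 1), (∑ r ∈ Finset.Ico 2 k, f r * ((r - 1).choose i : ℚ)) * (x ^ i * y ^ (k - 2 - i)) := by
  rw [hF]
  have e1 : ∀ r ∈ Finset.Ico 2 k, f r * ((x + y) ^ (r - 1) * y ^ (k - 1 - r)) =
      ∑ i ∈ Finset.range (k - 1), f r * ((r - 1).choose i : ℚ) * (x ^ i * y ^ (k - 2 - i)) := by
    intro r hr
    rw [Finset.mem_Ico] at hr
    rw [add_pow, sum_mul, mul_sum]
    -- extend the Finset.range from `r - 1 + 1 = r` to `k - 1`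
    rw [show r - 1 + 1 = r by omega]
    rw [← sum_subset (s₁ := Finset.range r) (s₂ := Finset.range (k - 1))
      (fun i hi => by rw [Finset.mem_range] at hi ⊢; omega) (fun i hi hir => by
      rw [Finset.mem_range] at hi hir
      rw [Nat.choose_eq_zero_of_lt (by omega : r - 1 < i)]; simp)]
    refine sum_congr rfl fun i hi => ?_
    rw [Finset.mem_range] at hi
    have hy : y ^ (r - 1 - i) * y ^ (k - 1 - r) = y ^ (k - 2 - i) := by
      rw [← pow_add]; congr 1; omega
    rw [show f r * (x ^ i * y ^ (r - 1 - i) * ((r - 1).choose i : ℚ) * y ^ (k - 1 - r)) =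
      f r * ((r - 1).choose i : ℚ) * (x ^ i * (y ^ (r - 1 - i) * y ^ (k - 1 - r))) by ring, hy]
  rw [sum_congr rfl e1, sum_comm]
  refine sum_congr rfl fun i _ => ?_
  rw [sum_mul]

/-- Expansion of `F (x + y) x` in monomials (binomial theorem). [folklore] -/
theorem gf_shift_right {k : ℕ} (h3 : 3 ≤ k) (f : ℕ → ℚ)
    (F : ℚ → ℚ → ℚ) (hF : ∀ x y, F x y = ∑ r ∈ Finset.Ico 2 k, f r * (x ^ (r - 1) * y ^ (k - 1 - r)))
    (x y : ℚ) : F (x + y) x =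
      ∑ i ∈ Finset.range (k - 1), (∑ r ∈ Finset.Ico 2 k, f r * ((r - 1).choose (k - 2 - i) : ℚ)) * (x ^ i * y ^ (k - 2 - i)) := by
  have h := gf_shift_left h3 f F hF y x
  rw [add_comm] at h
  rw [h, ← sum_range_reflect]
  refine sum_congr rfl fun i hi => ?_
  rw [Finset.mem_range] at hi
  rw [show k - 1 - 1 - i = k - 2 - i by omega, show k - 2 - (k - 2 - i) = i by omega]
  ring

/-- Step 2 — the Euler decompositions and the sum formula in generating form:
`F(x+y,y) + F(x+y,x) = c (x^{k-2} + y^{k-2})`. [folklore] -/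
theorem gf_shuffle {k : ℕ} (h3 : 3 ≤ k) (f : ℕ → ℚ)
    (hE : ∀ a, 2 ≤ a → a + 2 ≤ k →
      ∑ r ∈ Finset.Ico 2 k, f r * (((r - 1).choose (a - 1) : ℚ) + ((r - 1).choose (k - 1 - a) : ℚ)) = 0)
    (hsum : ∑ r ∈ Finset.Ico 2 k, f r = 0)
    (F : ℚ → ℚ → ℚ) (hF : ∀ x y, F x y = ∑ r ∈ Finset.Ico 2 k, f r * (x ^ (r - 1) * y ^ (k - 1 - r)))
    (x y : ℚ) : F (x + y) y + F (x + y) x = f (k - 1) * (x ^ (k - 2) + y ^ (k - 2)) := by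
  rw [gf_shift_left h3 f F hF, gf_shift_right h3 f F hF, ← sum_add_distrib]
  have e : ∀ i ∈ Finset.range (k - 1),
      (∑ r ∈ Finset.Ico 2 k, f r * ((r - 1).choose i : ℚ)) * (x ^ i * y ^ (k - 2 - i)) +
        (∑ r ∈ Finset.Ico 2 k, f r * ((r - 1).choose (k - 2 - i) : ℚ)) * (x ^ i * y ^ (k - 2 - i)) =
      (∑ r ∈ Finset.Ico 2 k, f r * (((r - 1).choose i : ℚ) + ((r - 1).choose (k - 2 - i) : ℚ))) *
        (x ^ i * y ^ (k - 2 - i)) := by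
    intro i _
    rw [← add_mul, ← sum_add_distrib]
    congr 1
    exact sum_congr rfl fun r _ => by ring
  rw [sum_congr rfl e]
  -- the extreme coefficients
  have hc : ∑ r ∈ Finset.Ico 2 k, f r * (((r - 1).choose 0 : ℚ) + ((r - 1).choose (k - 2) : ℚ)) = f (k - 1) := by
    have : ∀ r ∈ Finset.Ico 2 k, f r * (((r - 1).choose 0 : ℚ) + ((r - 1).choose (k - 2) : ℚ)) =
        f r + (if r = k - 1 then f r else 0) := by
      intro r hr
      rw [Finset.mem_Ico] at hr
      rw [Nat.choose_zero_right]
      split_ifs with h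
      · rw [h, show k - 1 - 1 = k - 2 by omega, Nat.choose_self]; push_cast; ring
      · rw [Nat.choose_eq_zero_of_lt (by omega)]; push_cast; ring
    rw [sum_congr rfl this, sum_add_distrib, hsum, sum_ite_eq' (Finset.Ico 2 k) (k - 1) f, if_pos (by
      rw [Finset.mem_Ico]; omega), zero_add]
  -- split `Finset.range (k-1) = {0} ∪ Finset.Ico 1 (k-2) ∪ {k-2}`
  have hsplit : Finset.range (k - 1) = {0} ∪ (Finset.Ico 1 (k - 2) ∪ {k - 2}) := by
    ext i; simp only [Finset.mem_union, Finset.mem_range, Finset.mem_Ico, Finset.mem_singleton]; omega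
  have hd1 : Disjoint ({0} : Finset ℕ) (Finset.Ico 1 (k - 2) ∪ {k - 2}) := by
    rw [Finset.disjoint_singleton_left]; simp only [Finset.mem_union, Finset.mem_Ico, Finset.mem_singleton]; omega
  have hd2 : Disjoint (Finset.Ico 1 (k - 2)) {k - 2} := by
    rw [Finset.disjoint_singleton_right, Finset.mem_Ico]; omega
  rw [hsplit, sum_union hd1, sum_union hd2, sum_singleton, sum_singleton]
  have hmid : ∑ i ∈ Finset.Ico 1 (k - 2),
      (∑ r ∈ Finset.Ico 2 k, f r * (((r - 1).choose i : ℚ) + ((r - 1).choose (k - 2 - i) : ℚ))) *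
        (x ^ i * y ^ (k - 2 - i)) = 0 := by
    refine sum_eq_zero fun i hi => ?_
    rw [Finset.mem_Ico] at hi
    have h := hE (i + 1) (by omega) (by omega)
    rw [show i + 1 - 1 = i by omega, show k - 1 - (i + 1) = k - 2 - i by omega] at h
    rw [h, zero_mul]
  rw [hmid, show k - 2 - 0 = k - 2 by omega, show k - 2 - (k - 2) = 0 by omega, hc]
  have hc' : ∑ r ∈ Finset.Ico 2 k, f r * (((r - 1).choose (k - 2) : ℚ) + ((r - 1).choose 0 : ℚ)) = f (k - 1) := by
    rw [← hc]; exact sum_congr rfl fun r _ => by ring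
  rw [hc']
  ring

/-- Step 3 — for ODD `k` the two functional equations force `F(x,y) = c y^{k-2}`: iterate
`F(x,y) = F(x-y,x) + c(y^{k-2} - x^{k-2})` three times and use `F(-x,-y) = -F(x,y)`. [folklore] -/
theorem gf_eq_of_odd {k : ℕ} (hk : Odd k) (h3 : 3 ≤ k) (f : ℕ → ℚ) (c : ℚ)
    (F : ℚ → ℚ → ℚ) (hF : ∀ x y, F x y = ∑ r ∈ Finset.Ico 2 k, f r * (x ^ (r - 1) * y ^ (k - 1 - r)))
    (h1 : ∀ x y, F x y + F y x = c * (x ^ (k - 2) + y ^ (k - 2)))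
    (h2 : ∀ x y, F (x + y) y + F (x + y) x = c * (x ^ (k - 2) + y ^ (k - 2)))
    (x y : ℚ) : F x y = c * y ^ (k - 2) := by
  have hw : Odd (k - 2) := by obtain ⟨m, rfl⟩ := hk; exact ⟨m - 1, by omega⟩
  -- (3): F x y = F (x - y) x + c (y^w - x^w)
  have h3' : ∀ x y : ℚ, F x y = F (x - y) x + c * (y ^ (k - 2) - x ^ (k - 2)) := by
    intro x y
    have ha := h2 (x - y) y
    have hb := h1 (x - y) x
    simp only [sub_add_cancel] at ha
    linear_combination ha - hb
  -- oddness: F (-x) (-y) = - F x y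
  have hodd : ∀ x y : ℚ, F (-x) (-y) = -F x y := by
    intro x y
    rw [hF, hF, ← sum_neg_distrib]
    refine sum_congr rfl fun r hr => ?_
    rw [Finset.mem_Ico] at hr
    rw [neg_pow, neg_pow y]
    have : (-1 : ℚ) ^ (r - 1) * (-1) ^ (k - 1 - r) = -1 := by
      rw [← pow_add, show r - 1 + (k - 1 - r) = k - 2 by omega, hw.neg_one_pow]
    linear_combination (f r * x ^ (r - 1) * y ^ (k - 1 - r)) * this
  have e1 := h3' x y
  have e2 := h3' (x - y) x
  have e3 := h3' (x - y - x) (x - y)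
  rw [show x - y - x = -y by ring] at e2 e3
  rw [show -y - (x - y) = -x by ring, hodd] at e3
  have hneg : (-y) ^ (k - 2) = -y ^ (k - 2) := hw.neg_pow y
  rw [hneg] at e3
  linear_combination (1 / 2 : ℚ) * (e1 + e2 + e3)   -- hmm, check

/-- Step 4 — `F(x,y) = c y^{k-2}` with `F` free of the monomial `y^{k-2}` forces `c = 0` and all
coefficients `f r = 0` (a polynomial vanishing on `ℚ` is zero). [folklore] -/
theorem coeff_eq_zero_of_gf {k : ℕ} (f : ℕ → ℚ) (c : ℚ)
    (F : ℚ → ℚ → ℚ) (hF : ∀ x y, F x y = ∑ r ∈ Finset.Ico 2 k, f r * (x ^ (r - 1) * y ^ (k - 1 - r)))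
    (h : ∀ x y, F x y = c * y ^ (k - 2)) {r : ℕ} (hr2 : 2 ≤ r) (hrk : r < k) : f r = 0 := by
  -- at y = 1: ∑ f r x^{r-1} = c; at x = 0 this gives c = 0
  have h1 : ∀ x : ℚ, ∑ r ∈ Finset.Ico 2 k, f r * x ^ (r - 1) = c := by
    intro x
    have := h x 1
    rw [hF] at this
    simpa using this
  have hc : c = 0 := by
    have := h1 0
    rw [sum_eq_zero (fun r hr => by
      rw [Finset.mem_Ico] at hr
      rw [zero_pow (by omega : r - 1 ≠ 0), mul_zero])] at this
    exact this.symm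
  -- the polynomial `∑ f r X^{r-1}` vanishes identically, hence is zero
  set P : Polynomial ℚ := ∑ r ∈ Finset.Ico 2 k, Polynomial.C (f r) * Polynomial.X ^ (r - 1) with hP
  have hP0 : P = 0 := by
    refine Polynomial.funext fun x => ?_
    rw [hP, Polynomial.eval_finsetSum, Polynomial.eval_zero]
    simp only [Polynomial.eval_mul, Polynomial.eval_C, Polynomial.eval_pow, Polynomial.eval_X]
    rw [h1 x, hc]
  have hcoeff : P.coeff (r - 1) = f r := by
    rw [hP, Polynomial.finsetSum_coeff]
    simp only [Polynomial.coeff_C_mul_X_pow]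
    rw [sum_eq_single r (fun r' hr' hne => ?_) (fun hr => ?_)]
    · rw [if_pos rfl]
    · rw [Finset.mem_Ico] at hr'
      rw [if_neg (by omega)]
    · exact absurd (Finset.mem_Ico.2 ⟨hr2, hrk⟩) hr
  rw [← hcoeff, hP0, Polynomial.coeff_zero]

/-- Conversion of the Euler decomposition in the tree's indexing
(`multipleZeta_mul_eq_euler_decomposition`) to the `r`-indexed form
`∑_r [C(r-1,a-1) + C(r-1,k-1-a)] f r = 0`. [folklore] -/
theorem euler_rel_reindex {k : ℕ} (f : ℕ → ℚ) {a : ℕ} (ha : 2 ≤ a) (hak : a + 2 ≤ k)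
    (hE : (∑ i ∈ Finset.range a, ((k - a + i - 1).choose i : ℚ) * f (k - a + i)) +
      ∑ j ∈ Finset.range (k - a), ((a + j - 1).choose j : ℚ) * f (a + j) = 0) :
    ∑ r ∈ Finset.Ico 2 k, f r * (((r - 1).choose (a - 1) : ℚ) + ((r - 1).choose (k - 1 - a) : ℚ)) = 0 := by
  have e1 : ∑ i ∈ Finset.range a, ((k - a + i - 1).choose i : ℚ) * f (k - a + i) =
      ∑ r ∈ Finset.Ico 2 k, f r * ((r - 1).choose (k - 1 - a) : ℚ) := by
    have h1 : ∑ r ∈ Finset.Ico (k - a) k, f r * ((r - 1).choose (k - 1 - a) : ℚ) =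
        ∑ i ∈ Finset.range a, ((k - a + i - 1).choose i : ℚ) * f (k - a + i) := by
      rw [sum_Ico_eq_sum_range, show k - (k - a) = a by omega]
      refine sum_congr rfl fun i hi => ?_
      rw [Finset.mem_range] at hi
      rw [mul_comm, show k - 1 - a = (k - a + i - 1) - i by omega, Nat.choose_symm (by omega)]
    rw [← h1]
    symm
    rw [← sum_subset (s₁ := Finset.Ico (k - a) k) (s₂ := Finset.Ico 2 k) (fun r hr => by
      rw [Finset.mem_Ico] at hr ⊢; omega) (fun r hr hr' => by
      rw [Finset.mem_Ico] at hr hr'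
      rw [Nat.choose_eq_zero_of_lt (by omega), Nat.cast_zero, mul_zero])]
  have e2 : ∑ j ∈ Finset.range (k - a), ((a + j - 1).choose j : ℚ) * f (a + j) =
      ∑ r ∈ Finset.Ico 2 k, f r * ((r - 1).choose (a - 1) : ℚ) := by
    have h1 : ∑ r ∈ Finset.Ico a k, f r * ((r - 1).choose (a - 1) : ℚ) =
        ∑ j ∈ Finset.range (k - a), ((a + j - 1).choose j : ℚ) * f (a + j) := by
      rw [sum_Ico_eq_sum_range]
      refine sum_congr rfl fun j hj => ?_
      rw [Finset.mem_range] at hj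
      rw [mul_comm, show a - 1 = (a + j - 1) - j by omega, Nat.choose_symm (by omega)]
    rw [← h1]
    symm
    rw [← sum_subset (s₁ := Finset.Ico a k) (s₂ := Finset.Ico 2 k) (fun r hr => by
      rw [Finset.mem_Ico] at hr ⊢; omega) (fun r hr hr' => by
      rw [Finset.mem_Ico] at hr hr'
      rw [Nat.choose_eq_zero_of_lt (by omega), Nat.cast_zero, mul_zero])]
  rw [e1, e2, ← sum_add_distrib] at hE
  rw [← hE]
  exact sum_congr rfl fun r _ => by ring

/-- **The parity lemma**: for odd `k ≥ 3`, scalars `f r` (`2 ≤ r < k`) satisfying the depth-two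
stuffle relations, Euler decompositions and sum formula with vanishing depth-one sides are all
zero. [folklore] -/
theorem eq_zero_of_double_shuffle_odd {k : ℕ} (hk : Odd k) (h3 : 3 ≤ k) (f : ℕ → ℚ)
    (hS : ∀ a, 2 ≤ a → a + 2 ≤ k → f a + f (k - a) = 0)
    (hE : ∀ a, 2 ≤ a → a + 2 ≤ k →
      (∑ i ∈ Finset.range a, ((k - a + i - 1).choose i : ℚ) * f (k - a + i)) +
        ∑ j ∈ Finset.range (k - a), ((a + j - 1).choose j : ℚ) * f (a + j) = 0)
    (hsum : ∑ i ∈ Finset.range (k - 2), f (i + 2) = 0) {r : ℕ} (hr2 : 2 ≤ r) (hrk : r < k) :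
    f r = 0 := by
  set F : ℚ → ℚ → ℚ := fun x y => ∑ r ∈ Finset.Ico 2 k, f r * (x ^ (r - 1) * y ^ (k - 1 - r)) with hFdef
  have hF : ∀ x y, F x y = ∑ r ∈ Finset.Ico 2 k, f r * (x ^ (r - 1) * y ^ (k - 1 - r)) := fun x y => rfl
  have hsum' : ∑ r ∈ Finset.Ico 2 k, f r = 0 := by
    rw [sum_Ico_eq_sum_range, ← hsum]
    exact sum_congr rfl fun i _ => by rw [add_comm]
  have hE' : ∀ a, 2 ≤ a → a + 2 ≤ k →
      ∑ r ∈ Finset.Ico 2 k, f r * (((r - 1).choose (a - 1) : ℚ) + ((r - 1).choose (k - 1 - a) : ℚ)) = 0 :=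
    fun a ha hak => euler_rel_reindex f ha hak (hE a ha hak)
  have h1 := gf_symm h3 f hS F hF
  have h2 := gf_shuffle h3 f hE' hsum' F hF
  have h := gf_eq_of_odd hk h3 f (f (k - 1)) F hF h1 h2
  exact coeff_eq_zero_of_gf f (f (k - 1)) F hF h hr2 hrk


end EulerOddWeight

/-! ### Euler's theorem: double zeta values of odd weight -/

/-- The harmonic product in depth one: `ζ(a) ζ(b) = ζ(a,b) + ζ(b,a) + ζ(a+b)` (`a, b ≥ 2`).
[cite: Hoffman1997, Theorem 4.2] -/
theorem multipleZeta_singleton_mul_singleton {a b : ℕ} (ha : 2 ≤ a) (hb : 2 ≤ b) :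
    multipleZeta [a] * multipleZeta [b] =
      multipleZeta [a, b] + multipleZeta [b, a] + multipleZeta [a + b] := by
  have h := multipleZeta_mul (MZV.isAdmissible_singleton_of_two_le ha)
    (MZV.isAdmissible_singleton_of_two_le hb)
  rw [MZV.stuffle_cons_cons] at h
  simp at h
  linarith [h]

/-- **Euler's theorem on double zeta values of odd weight**, abstract form: if `k ≥ 3` is odd and a
`ℚ`-subspace `V ⊆ ℝ` contains `ζ(k)` and the products `ζ(a) ζ(k-a)` (`2 ≤ a ≤ k-2`), then `V`
contains every `ζ(r, k-r)`, `2 ≤ r ≤ k-1`. [cite: Eie2013, Appendix B, Theorems B.1.1–B.1.2] -/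
theorem multipleZeta_depth_two_mem_of_odd (V : Submodule ℚ ℝ) {k : ℕ} (hk : Odd k) (h3 : 3 ≤ k)
    (hVk : multipleZeta [k] ∈ V)
    (hVprod : ∀ a, 2 ≤ a → a + 2 ≤ k → multipleZeta [a] * multipleZeta [k - a] ∈ V)
    {r : ℕ} (hr2 : 2 ≤ r) (hrk : r < k) : multipleZeta [r, k - r] ∈ V := by
  rw [← Submodule.Quotient.mk_eq_zero V, ← Submodule.mkQ_apply,
    ← Module.forall_dual_apply_eq_zero_iff ℚ]
  intro lf
  -- the scalars `f r = φ [ζ(r, k-r)]`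
  set f : ℕ → ℚ := fun r => lf (V.mkQ (multipleZeta [r, k - r])) with hf
  have hq : ∀ x ∈ V, lf (V.mkQ x) = 0 := fun x hx => by
    rw [Submodule.mkQ_apply, (Submodule.Quotient.mk_eq_zero V).2 hx, map_zero]
  -- stuffle
  have hS : ∀ a, 2 ≤ a → a + 2 ≤ k → f a + f (k - a) = 0 := by
    intro a ha hak
    have h := multipleZeta_singleton_mul_singleton ha (by omega : 2 ≤ k - a)
    rw [show a + (k - a) = k by omega] at h
    have h' : multipleZeta [a, k - a] + multipleZeta [k - a, a] =
        multipleZeta [a] * multipleZeta [k - a] - multipleZeta [k] := by linarith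
    have := congrArg (fun x => lf (V.mkQ x)) h'
    simp only [map_add, map_sub, hq _ hVk, hq _ (hVprod a ha hak), sub_zero] at this
    simp only [hf, show k - (k - a) = a by omega]
    exact this
  -- Euler decomposition
  have hE : ∀ a, 2 ≤ a → a + 2 ≤ k →
      (∑ i ∈ Finset.range a, ((k - a + i - 1).choose i : ℚ) * f (k - a + i)) +
        ∑ j ∈ Finset.range (k - a), ((a + j - 1).choose j : ℚ) * f (a + j) = 0 := by
    intro a ha hak
    have h := multipleZeta_mul_eq_euler_decomposition ha (by omega : 2 ≤ k - a)
    have := congrArg (fun x => lf (V.mkQ x)) h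
    simp only [map_add, map_sum, hq _ (hVprod a ha hak)] at this
    rw [eq_comm] at this
    rw [← this]
    congr 1
    · refine sum_congr rfl fun i hi => ?_
      rw [Finset.mem_range] at hi
      simp only [hf, show k - (k - a + i) = a - i by omega]
      rw [← smul_eq_mul, ← map_smul, ← map_smul]
      congr 2
    · refine sum_congr rfl fun j hj => ?_
      rw [Finset.mem_range] at hj
      simp only [hf, show k - (a + j) = k - a - j by omega]
      rw [← smul_eq_mul, ← map_smul, ← map_smul]
      congr 2
  -- sum formula
  have hsum : ∑ i ∈ Finset.range (k - 2), f (i + 2) = 0 := by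
    have h := multipleZeta_sum_formula_depth_two h3
    have := congrArg (fun x => lf (V.mkQ x)) h
    simp only [map_sum, hq _ hVk] at this
    rw [← this]
    refine sum_congr rfl fun i hi => ?_
    rw [Finset.mem_range] at hi
    simp only [hf, show k - (i + 2) = k - 2 - i by omega]
  exact EulerOddWeight.eq_zero_of_double_shuffle_odd hk h3 f hS hE hsum hr2 hrk

/-- **Euler's theorem on double zeta values of odd weight** (Euler 1775, Nielsen; classical form):
for odd `k` and `2 ≤ r ≤ k-1`, `ζ(r, k-r)` is a `ℚ`-linear combination of `ζ(k)` and the products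
`ζ(a) ζ(k-a)`, `2 ≤ a ≤ k-2`. [cite: Eie2013, Appendix B, Theorems B.1.1–B.1.2] -/
theorem multipleZeta_depth_two_mem_span_of_odd {k : ℕ} (hk : Odd k) {r : ℕ} (hr2 : 2 ≤ r)
    (hrk : r < k) :
    multipleZeta [r, k - r] ∈ Submodule.span ℚ
      ({multipleZeta [k]} ∪ {x | ∃ a, 2 ≤ a ∧ a + 2 ≤ k ∧ x = multipleZeta [a] * multipleZeta [k - a]}) := by
  refine multipleZeta_depth_two_mem_of_odd _ hk (by omega) ?_ ?_ hr2 hrk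
  · exact Submodule.subset_span (Set.mem_union_left _ rfl)
  · intro a ha hak
    exact Submodule.subset_span (Set.mem_union_right _ ⟨a, ha, hak, rfl⟩)

/-- Products `ζ(a) ζ(k-a)` of odd total weight lie in the Hoffman span (one factor is an even zeta
value `∈ ℚ π^{2m}`). [cite: Brown2012, Theorem 1.1] -/
theorem multipleZeta_singleton_mul_singleton_mem_hoffmanSpan_of_odd {k : ℕ} (hk : Odd k) {a : ℕ}
    (ha : 2 ≤ a) (hak : a + 2 ≤ k) :
    multipleZeta [a] * multipleZeta [k - a] ∈ hoffmanSpan k := by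
  rcases Nat.even_or_odd a with he | ho
  · -- `a = 2m` even: `ζ(2m) ζ(k-2m) = q π^{2m} ζ(k - 2m)`
    obtain ⟨m, rfl⟩ := he
    have hm : m ≠ 0 := by omega
    have h := pi_pow_mul_multipleZeta_singleton_mem_hoffmanSpan (by omega : 2 ≤ k - (m + m)) m
    rw [show k - (m + m) + 2 * m = k by omega] at h
    have e : multipleZeta [m + m] * multipleZeta [k - (m + m)] =
        ((-1) ^ (m + 1) * 2 ^ (2 * m - 1) * bernoulli (2 * m) / (2 * m)! : ℚ) •
          (π ^ (2 * m) * multipleZeta [k - (m + m)]) := by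
      rw [← two_mul, multipleZeta_two_mul_eq hm, Rat.smul_def]
      push_cast
      ring
    rw [e]
    exact Submodule.smul_mem _ _ h
  · -- `a` odd, so `k - a = 2m` is even
    have he : Even (k - a) := by
      obtain ⟨m, rfl⟩ := hk; obtain ⟨n, rfl⟩ := ho; exact ⟨m - n, by omega⟩
    obtain ⟨m, hm⟩ := he
    have hm0 : m ≠ 0 := by omega
    have h := pi_pow_mul_multipleZeta_singleton_mem_hoffmanSpan ha m
    rw [show a + 2 * m = k by omega] at h
    have e : multipleZeta [a] * multipleZeta [k - a] =
        ((-1) ^ (m + 1) * 2 ^ (2 * m - 1) * bernoulli (2 * m) / (2 * m)! : ℚ) •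
          (π ^ (2 * m) * multipleZeta [a]) := by
      rw [hm, ← two_mul, multipleZeta_two_mul_eq hm0, Rat.smul_def]
      push_cast
      ring
    rw [e]
    exact Submodule.smul_mem _ _ h

/-- **All double zeta values of odd weight lie in the Hoffman span**: for odd `k` and
`2 ≤ r ≤ k-1`, `ζ(r, k-r) ∈ hoffmanSpan k` — Brown's Theorem 1.1 (Hoffman's Conjecture 2) for
depth two and odd weight, UNCONDITIONALLY (Euler's theorem + the depth-one case).
[cite: Brown2012, Theorem 1.1] -/
theorem multipleZeta_depth_two_mem_hoffmanSpan_of_odd {k : ℕ} (hk : Odd k) {r : ℕ} (hr2 : 2 ≤ r)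
    (hrk : r < k) : multipleZeta [r, k - r] ∈ hoffmanSpan k :=
  multipleZeta_depth_two_mem_of_odd _ hk (by omega) (multipleZeta_singleton_mem_hoffmanSpan (by omega))
    (fun _ ha hak => multipleZeta_singleton_mul_singleton_mem_hoffmanSpan_of_odd hk ha hak) hr2 hrk

/-- Every multiple zeta value of depth `≤ 2` and odd weight lies in the Hoffman span of its weight.
[cite: Brown2012, Theorem 1.1] -/
theorem multipleZeta_mem_hoffmanSpan_of_length_le_two_of_odd {s : List ℕ} (hs : MZV.IsAdmissible s)
    (hl : s.length ≤ 2) (hodd : Odd (MZV.weight s)) :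
    multipleZeta s ∈ hoffmanSpan (MZV.weight s) := by
  match s, hl with
  | [], _ => simp [MZV.weight] at hodd
  | [k], _ => exact multipleZeta_mem_hoffmanSpan_of_length_eq_one hs rfl
  | [r, t], _ =>
    have hr : 2 ≤ r := by simpa using hs.2 (by simp)
    have ht : 1 ≤ t := hs.1 t (by simp)
    have hw : MZV.weight [r, t] = r + t := by simp [MZV.weight]
    rw [hw] at hodd ⊢
    have h := multipleZeta_depth_two_mem_hoffmanSpan_of_odd hodd hr (by omega : r < r + t)
    rwa [show r + t - r = t by omega] at h

/-! ### Duals: indices whose dual has depth `≤ 2` -/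

/-- By the duality `ζ(τ(s)) = ζ(s)` (`multipleZeta_dual`), every admissible index of odd weight whose
DUAL has depth `≤ 2` also gives a multiple zeta value in the Hoffman span — e.g. the height-one
values `ζ(2, 1, …, 1) = ζ(k)` and the duals `τ(r, s)` of the odd-weight double zeta values.
[cite: Brown2012, Theorem 1.1] -/
theorem multipleZeta_mem_hoffmanSpan_of_dual_length_le_two_of_odd {s : List ℕ}
    (hs : MZV.IsAdmissible s) (hl : (MZV.dual s).length ≤ 2) (hodd : Odd (MZV.weight s)) :
    multipleZeta s ∈ hoffmanSpan (MZV.weight s) := by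
  rw [← multipleZeta_dual hs, ← MZV.weight_dual hs]
  rw [← MZV.weight_dual hs] at hodd
  exact multipleZeta_mem_hoffmanSpan_of_length_le_two_of_odd (MZV.isAdmissible_dual hs) hl hodd

/-- A sanity instance of the dual criterion: `ζ(2,2,1) ∈ hoffmanSpan 5` (`τ(2,2,1) = (3,2)`,
`MZV.dual_examples`). [folklore] -/
example : multipleZeta [2, 2, 1] ∈ hoffmanSpan 5 :=
  multipleZeta_mem_hoffmanSpan_of_dual_length_le_two_of_odd (s := [2, 2, 1])
    ⟨by decide, fun _ => by simp⟩ (by rw [MZV.dual_examples.2.1]; decide) (by decide)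

end Literature.NumberTheory.Transcendental
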